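/-
Copyright (c) 2026. All rights reserved.
Released under Apache 2.0 license as described in the file LICENSE.
-/
import Literature.AlgebraicGeometry.ComplexMultiplication.HyperellipticJacobianLevelDivisibleByFour
import Literature.NumberTheory.ComplexMultiplication.CMTypeGaloisClassesInduced
import Literature.NumberTheory.ComplexMultiplication.QuarticCMTypes
import HarnessLib

/-!
# The reflex fields of the CM types `Φ_m` of the factors `X_m` of `J_m = Jac(y² = x^m + 1)`:
# `ℚ(ζ_m)` iff `m` is odd or `m ≡ 2 (mod 4)`; `ℚ(ζ_m − ζ_m⁻¹)` for `4 ∣ m ∉ {20, 24, 60}`; `F_m` at `20, 24, 60`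

Layer `Literature/AlgebraicGeometry/ComplexMultiplication`, namespace `…ComplexMultiplication.HyperellipticJacobian`; the sequel of
`HyperellipticJacobianLevelDivisibleByFour` (GGL Lemma 12 at `4 ∣ m`, the primitive sub-pair `(K₁, Φ₁)` of `Φ_m` with
`K₁ = ℚ(ζ_m − ζ_m^{−1})`, the exceptional fields `F_{20}, F_{24}, F_{60}`), of `HyperellipticJacobianTwiceOddLevel` and
`HyperellipticJacobianExceptionalClasses` (primitivity at the levels `m ≡ 2 (mod 4)` and `m` odd), read against the tree's
complex reflex field `traceField Φ = ℚ(Σ_{φ ∈ Φ} φ(x) : x ∈ K) ⊂ ℂ` (Shimura §8.3 Prop. 28, `ComplexReflexField`) and its two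
structural theorems for ABELIAN `K`: `traceField_eq_fieldRange_of_isPrimitive_of_isAbelianGalois` («if `F` is abelian over `ℚ` and
`(F; {φᵢ})` is primitive, the reflex of `(F; {φᵢ})` is `(F; {φᵢ⁻¹})`», §8.4 Example (1)) and `traceField_inducedCMType_ringHom`
(Milne Prop. 1.18 (c): the reflex field of `Φ₁^K` is that of `Φ₁`).  THEOREMS ONLY (no definition, no named fact, no `sorry`,
no instance).

## The print and what this file records about it

A. Gallese, H. Goodson, D. Lombardo, *Monodromy groups and exceptional Hodge classes, I: Fermat Jacobians*, arXiv:2405.20394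
[GalleseGoodsonLombardo2024] (held `paper:arxiv-2405.20394`, p0014 read first-hand), §3.5, proof of PROPOSITION 13 («The
endomorphism field `ℚ(End(J_m))` is a finite extension of the cyclotomic field `ℚ(ζ_m)` …»): «Lemma 11 states that the abelian
variety `X_d` has complex multiplication by `ℚ(ζ_d)` and its CM-type is `Φ_d` … Notice that the reflex field is `ℚ(ζ_d)`.
Applying [Lang], we obtain that the endomorphism field of `X_d` contains `ℚ(ζ_d)`.»

Read on the tree's carriers (the lower-half type `Φ_d = {σ : 2⟨e(σ)⟩ < d}` of `K = ℚ(ζ_d)`, Lemma 11; the reflex field as the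
subfield `traceField Φ_d` of `ℂ`; `x : K → ℂ` any embedding, all of which have the same image `x(K) = ℚ(ζ_d) ⊂ ℂ`):
* for `d` ODD and for `d ≡ 2 (mod 4)` the sentence holds AS PRINTED: `traceField Φ_d = x(ℚ(ζ_d))` (§§1–2);
* for `4 ∣ d`, `d ≥ 8`, it does NOT: `Φ_d` is induced from the primitive sub-pair on `K₁ = ℚ(ζ_d − ζ_d^{−1})` (GGL's own Thm. 3.0 (5)
  and Lemma 12: the stabiliser of `Φ_d` is `{1, d/2 − 1}`), so its reflex field is the reflex field of `Φ₁`, namely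
  `x(K₁) = ℚ(x(ζ_d) − x(ζ_d)^{−1}) ⊊ x(ℚ(ζ_d))`, of degree `φ(d)/2` — the CM field of `Y_d`, not of `X_d` (§3); at `d = 20, 24, 60`
  it is `x(F_d)` of degree `2, 2, 4` (§4).  (Prop. 13's conclusion `ℚ(End(J_m)) ⊇ ℚ(ζ_m)` is not a statement of this file and
  is not disputed here; only the parenthetical identification of the reflex field is corrected at the levels `4 ∣ d`.)

Shimura, *Abelian Varieties with Complex Multiplication and Modular Functions* (1998) [Shimura1998] §8.3 Prop. 28 (the reflex
field `K* = ℚ(Σᵢ ξ^{φᵢ})`), §8.4 Example (1) (abelian `F`, primitive type: `K* = F`); J. S. Milne, *Complex Multiplication*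
[MilneCM2006] Ch. I §1 Prop. 1.18 (c) (reflex field of an extended type).

## What is proved (`x : K →+* ℂ` arbitrary; `K` with `IsCyclotomicExtension {m} ℚ K`)

* §0 (any ABELIAN CM field `K`, any type): **`traceField_eq_map_of_primitive_subpair`** — for `Φ = Φ₁^K` induced from a
  primitive sub-pair `(K₁, Φ₁)` (`Aut(ℂ)`-form), `traceField Φ = K₁.map x` (the image `x(K₁) ⊂ ℂ`), and
  `finrank_traceField_eq_of_primitive_subpair` (`[K* : ℚ] = [K₁ : ℚ]`).
* §1 (`m` odd `≥ 3`): **`traceField_eq_fieldRange_odd`** (`traceField Φ_m = x(ℚ(ζ_m))`), `finrank_traceField_odd` (`= φ(m)`).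
* §2 (`m = 2n`, `n` odd `≥ 3`): **`traceField_eq_fieldRange_twiceOdd`**, `finrank_traceField_twiceOdd` (`= φ(2n)`).
* §3 (`4 ∣ m ≥ 8`, `m ∉ {20, 24, 60}`): **`traceField_eq_adjoin_of_four_dvd`** (`traceField Φ_m = ℚ(x(ζ) − x(ζ)⁻¹)`),
  `two_mul_finrank_traceField_of_four_dvd` (`2·[K* : ℚ] = φ(m)`), **`traceField_lt_fieldRange_of_four_dvd`**
  (`traceField Φ_m < x(ℚ(ζ_m))`: the reflex field is NOT `ℚ(ζ_m)`), `traceField_ne_fieldRange_of_four_dvd`.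
* §4 (`m ∈ {20, 24, 60}`): **`traceField_twenty`** (`= ℚ(x r)`, `r = ζ + ζ³ + ζ⁷ + ζ⁹`, `(x r)² = −5`, degree `2`),
  **`traceField_twentyFour`** (`(x r)² = −6`, degree `2`), **`traceField_sixty`** (`(x r)⁴ + 15 (x r)² + 45 = 0`, degree `4`);
  in each case `traceField Φ ≠ x(ℚ(ζ_m))`.

## Honest column ∕ NOT here

The reflex TYPE and reflex norm of `Φ_m` (tree `ReflexCMType` for fields in general; not specialised here), fields of definition
∕ moduli of `X_m`, `Y_m` (Shimura's Main Theorem), the endomorphism field `ℚ(End(J_m))` of Prop. 13 ∕ Thm. 18, and the reflex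
field of the CM-ALGEBRA type of `J_m` (Milne Prop. 1.18 (b): the compositum — for `m` odd all `x(ℚ(ζ_d))`, `d ∣ m`, lie in
`x(ℚ(ζ_m))`; not typed).  `HC_CM` is not touched.

## References

* [GalleseGoodsonLombardo2024] A. Gallese, H. Goodson, D. Lombardo, arXiv:2405.20394 — §3.1 Lemma 11, §3.2 Lemma 12, §3 Thm. 3.0 (5)–(6),
  §3.4, §3.5 Prop. 13 (proof, the sentence «Notice that the reflex field is ℚ(ζ_d)»).
* [Shimura1998] G. Shimura — §8.3 Prop. 28, §8.4 Example (1) (p. 85).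
* [MilneCM2006] J. S. Milne, *Complex Multiplication* — Ch. I §1 Prop. 1.16, Def. 1.17, Prop. 1.18 (c).

## Provenance

Cell `pub-hodgecm2` (COR-CM), KEPT Literature lane `lit-deligne-3` gen 51 (claim GGL24-PROP13-REFLEX-FIELDS; count-neutral, own lane).
-/

noncomputable section

open NumberField Module

namespace Literature.AlgebraicGeometry.ComplexMultiplication

open Literature.AlgebraicGeometry.Motives (CMType)
open Literature.NumberTheory.ComplexMultiplication

/-! ## §0 Abelian `K`: the reflex field of a type is the image of the field of its primitive sub-pair -/

section Abelian

variable {K : Type} [Field K] [NumberField K] [IsAbelianGalois ℚ K]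

/-- **Shimura §8.4 Example (1) with Milne Prop. 1.18 (c), for an ABELIAN CM field `K`: the reflex field of a type `Φ = Φ₁^K`
induced from a primitive sub-pair `(K₁, Φ₁)` is `x(K₁) ⊂ ℂ`** (for every complex embedding `x` of `K`): `K*(Φ) = K*(Φ₁)`
(Prop. 1.18 (c), tree `traceField_inducedCMType_ringHom`) and `K*(Φ₁) = x(K₁)` for the primitive type `Φ₁` of the abelian
field `K₁` (Example (1), tree `traceField_eq_fieldRange_of_isPrimitive_of_isAbelianGalois`).
[cite: Shimura1998, §8.4 Example (1) (p. 85) and §8.3 Prop. 28] [cite: MilneCM2006, Ch. I §1 Prop. 1.18 (c)] -/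
theorem traceField_eq_map_of_primitive_subpair (Φ : CMType K) {K₁ : IntermediateField ℚ K} (Φ₁ : CMType K₁)
    (h₁ : inducedCMType (algebraMap K₁ K) Φ₁ = Φ)
    (hp₁ : ∀ s t : K₁ →+* ℂ,
      (∀ τ : ℂ ≃+* ℂ, ((τ : ℂ →+* ℂ).comp s ∈ Φ₁.1 ↔ (τ : ℂ →+* ℂ).comp t ∈ Φ₁.1)) → s = t)
    (x : K →+* ℂ) : traceField Φ = K₁.map x.toRatAlgHom := by
  haveI : IsAbelianGalois ℚ K₁ := IsAbelianGalois.tower_bot ℚ K₁ K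
  set x₁ : K₁ →+* ℂ := x.comp (algebraMap K₁ K) with hx₁
  have hprim : IsPrimitive (ℂ ≃+* ℂ) Φ₁.1 x₁ := (isPrimitive_ringEquiv_complex_iff Φ₁ x₁).2 hp₁
  rw [← h₁, traceField_inducedCMType_ringHom, traceField_eq_fieldRange_of_isPrimitive_of_isAbelianGalois x₁ Φ₁ hprim,
    ← IntermediateField.fieldRange_comp_val]
  congr 1

/-- `[K* : ℚ] = [K₁ : ℚ]` in the situation of `traceField_eq_map_of_primitive_subpair`.
[cite: Shimura1998, §8.4 Example (1) (p. 85)] [cite: MilneCM2006, Ch. I §1 Prop. 1.18 (c)] -/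
theorem finrank_traceField_eq_of_primitive_subpair (Φ : CMType K) {K₁ : IntermediateField ℚ K} (Φ₁ : CMType K₁)
    (h₁ : inducedCMType (algebraMap K₁ K) Φ₁ = Φ)
    (hp₁ : ∀ s t : K₁ →+* ℂ,
      (∀ τ : ℂ ≃+* ℂ, ((τ : ℂ →+* ℂ).comp s ∈ Φ₁.1 ↔ (τ : ℂ →+* ℂ).comp t ∈ Φ₁.1)) → s = t) :
    finrank ℚ (traceField Φ) = finrank ℚ K₁ := by
  obtain ⟨x⟩ := (inferInstance : Nonempty (K →+* ℂ))
  rw [traceField_eq_map_of_primitive_subpair Φ Φ₁ h₁ hp₁ x]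
  exact (IntermediateField.equivMap K₁ x.toRatAlgHom).toLinearEquiv.finrank_eq.symm

omit [IsAbelianGalois ℚ K] in
/-- `[x(K) : ℚ] = [K : ℚ]` for the image of an embedding. [folklore] -/
private theorem finrank_fieldRange (x : K →+* ℂ) : finrank ℚ x.toRatAlgHom.fieldRange = finrank ℚ K := by
  rw [← IntermediateField.finrank_eq_finrank_subalgebra, AlgHom.fieldRange_toSubalgebra]
  exact (AlgEquiv.ofInjectiveField x.toRatAlgHom).toLinearEquiv.finrank_eq.symm

end Abelian

namespace HyperellipticJacobian

open Literature.AlgebraicGeometry.Pohlmann1968 Literature.AlgebraicGeometry.Pohlmann1968.Cyclotomic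
open CyclotomicCMTypeResidueSets

/-! ## §1 `m` odd: the reflex field of `Φ_m` is `ℚ(ζ_m)` (as printed) -/

section Odd

variable {m : ℕ} [NeZero m] {K : Type} [Field K] [NumberField K] [IsCyclotomicExtension {m} ℚ K]

/-- **GGL Prop. 13 (proof), `d` odd: «the reflex field [of `Φ_d`] is `ℚ(ζ_d)`»** — for the lower-half type `Φ` of `K = ℚ(ζ_m)`,
`m` odd, `traceField Φ = x(K)` for every embedding `x` (`Φ` is primitive, Goodson Lemma 4.3 ∕ GGL Lemma 12, tree
`isPrimitive_of_levels`; `K` is abelian; Shimura §8.4 Example (1)).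
[cite: GalleseGoodsonLombardo2024, §3.5 Prop. 13 (proof) and §3.2 Lemma 12] [cite: Shimura1998, §8.4 Example (1) (p. 85)] -/
theorem traceField_eq_fieldRange_odd (hm : Odd m) (Φ : CMType K) (hΦ : ∀ σ : K →+* ℂ, σ ∈ Φ.1 ↔ 2 * (expOf m K σ).val < m)
    (x : K →+* ℂ) : traceField Φ = x.toRatAlgHom.fieldRange := by
  haveI : IsAbelianGalois ℚ K := IsCyclotomicExtension.isAbelianGalois {m} ℚ K
  have hprim : IsPrimitive (ℂ ≃+* ℂ) Φ.1 x :=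
    isPrimitive_of_levels (k := 1) (lev := fun _ => m) (K := fun _ => K) (Φ := fun _ => Φ) (M := m) hm
      (fun _ => dvd_rfl) (fun i j _ => Subsingleton.elim i j) (fun _ σ => hΦ σ) 0 x
  exact traceField_eq_fieldRange_of_isPrimitive_of_isAbelianGalois x Φ hprim

/-- `[K* : ℚ] = φ(m)` for the lower-half type at an odd level. [cite: GalleseGoodsonLombardo2024, §3.5 Prop. 13 (proof)]
[cite: Shimura1998, §8.4 Example (1) (p. 85)] -/
theorem finrank_traceField_odd (hm : Odd m) (Φ : CMType K) (hΦ : ∀ σ : K →+* ℂ, σ ∈ Φ.1 ↔ 2 * (expOf m K σ).val < m) :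
    finrank ℚ (traceField Φ) = Nat.totient m := by
  obtain ⟨x⟩ := (inferInstance : Nonempty (K →+* ℂ))
  rw [traceField_eq_fieldRange_odd hm Φ hΦ x, finrank_fieldRange x]
  exact IsCyclotomicExtension.finrank (K := ℚ) (n := m) K
    (Polynomial.cyclotomic.irreducible_rat (Nat.pos_of_ne_zero (NeZero.ne m)))

end Odd

/-! ## §2 `m = 2n ≡ 2 (mod 4)`: the reflex field of `Φ_{2n}` is `ℚ(ζ_{2n})` (as printed) -/

section TwiceOdd

variable {n : ℕ} [NeZero n] [NeZero (2 * n)] {L : Type} [Field L] [NumberField L] [IsCyclotomicExtension {2 * n} ℚ L]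

/-- **GGL Prop. 13 (proof), `d = 2n ≡ 2 (mod 4)`: the reflex field of `Φ_{2n}` is `x(ℚ(ζ_{2n}))`** (`Φ_{2n}` is primitive,
GGL Lemma 12 at `m = 4k+2`, tree `isPrimitive_half_twiceOdd`). [cite: GalleseGoodsonLombardo2024, §3.5 Prop. 13 (proof) and §3.2 Lemma 12]
[cite: Shimura1998, §8.4 Example (1) (p. 85)] -/
theorem traceField_eq_fieldRange_twiceOdd (hn : Odd n) (h3 : 3 ≤ n) (Φ : CMType L)
    (hΦ : ∀ σ : L →+* ℂ, σ ∈ Φ.1 ↔ 2 * (expOf (2 * n) L σ).val < 2 * n) (x : L →+* ℂ) :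
    traceField Φ = x.toRatAlgHom.fieldRange := by
  haveI : IsAbelianGalois ℚ L := IsCyclotomicExtension.isAbelianGalois {2 * n} ℚ L
  exact traceField_eq_fieldRange_of_isPrimitive_of_isAbelianGalois x Φ (isPrimitive_half_twiceOdd hn h3 hΦ x).1

/-- `[K* : ℚ] = φ(2n)` for the lower-half type at a level `2n`, `n` odd `≥ 3`. [cite: GalleseGoodsonLombardo2024, §3.5 Prop. 13 (proof)]
[cite: Shimura1998, §8.4 Example (1) (p. 85)] -/
theorem finrank_traceField_twiceOdd (hn : Odd n) (h3 : 3 ≤ n) (Φ : CMType L)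
    (hΦ : ∀ σ : L →+* ℂ, σ ∈ Φ.1 ↔ 2 * (expOf (2 * n) L σ).val < 2 * n) :
    finrank ℚ (traceField Φ) = Nat.totient (2 * n) := by
  obtain ⟨x⟩ := (inferInstance : Nonempty (L →+* ℂ))
  rw [traceField_eq_fieldRange_twiceOdd hn h3 Φ hΦ x, finrank_fieldRange x]
  exact IsCyclotomicExtension.finrank (K := ℚ) (n := 2 * n) L
    (Polynomial.cyclotomic.irreducible_rat (Nat.pos_of_ne_zero (NeZero.ne (2 * n))))

end TwiceOdd

/-! ## §3 `4 ∣ m`, `m ∉ {20, 24, 60}`: the reflex field of `Φ_m` is `ℚ(ζ_m − ζ_m⁻¹)`, NOT `ℚ(ζ_m)` -/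

section FourDvd

variable {m : ℕ} [NeZero m] {K : Type} [Field K] [NumberField K] [IsCyclotomicExtension {m} ℚ K]

/-- **The reflex field of `Φ_m` for `4 ∣ m ≥ 8`, `m ∉ {20, 24, 60}`, is `ℚ(x(ζ) − x(ζ)⁻¹) ⊂ ℂ`** — the image of the CM field
`K₁ = ℚ(ζ_m − ζ_m^{−1})` of the primitive sub-pair (of `Y_m`), for every embedding `x` of `K = ℚ(ζ_m)`: `Φ_m = Φ₁^K` with
`(K₁, Φ₁)` primitive (GGL Thm. 3.0 (5) ∕ Lemma 12, tree `exists_primitive_inducedCMType_index_two_of_four_dvd`,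
`eq_fixedField_and_eq_adjoin_of_primitive_of_four_dvd`) and §0.  This CORRECTS, at the levels `4 ∣ d`, the parenthetical
«Notice that the reflex field is `ℚ(ζ_d)`» in the proof of Prop. 13.
[cite: GalleseGoodsonLombardo2024, §3.5 Prop. 13 (proof), §3 Thm. 3.0 (5) and §3.3] [cite: Shimura1998, §8.4 Example (1) (p. 85)]
[cite: MilneCM2006, Ch. I §1 Prop. 1.18 (c)] -/
theorem traceField_eq_adjoin_of_four_dvd (h4 : 4 ∣ m) (h8 : 8 ≤ m) (h20 : m ≠ 20) (h24 : m ≠ 24) (h60 : m ≠ 60)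
    (Φ : CMType K) (hΦ : ∀ σ : K →+* ℂ, σ ∈ Φ.1 ↔ 2 * (expOf m K σ).val < m) (x : K →+* ℂ) :
    traceField Φ = IntermediateField.adjoin ℚ {x (zetaOf m K) - (x (zetaOf m K))⁻¹} := by
  haveI : IsAbelianGalois ℚ K := IsCyclotomicExtension.isAbelianGalois {m} ℚ K
  obtain ⟨K₁, Φ₁, h₁, hp₁, -⟩ := exists_primitive_inducedCMType_index_two_of_four_dvd h4 h8 h20 h24 h60 Φ hΦ
  obtain ⟨-, -, -, -, -, -, -, -, hK₁⟩ := eq_fixedField_and_eq_adjoin_of_primitive_of_four_dvd h4 h8 h20 h24 h60 Φ hΦ Φ₁ h₁ hp₁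
  rw [traceField_eq_map_of_primitive_subpair Φ Φ₁ h₁ hp₁ x, hK₁, IntermediateField.adjoin_map, Set.image_singleton]
  simp [map_sub, map_inv₀]

/-- **`2·[K* : ℚ] = φ(m)`** for the lower-half type at a level `4 ∣ m ≥ 8`, `m ∉ {20, 24, 60}` (the reflex field has index `2` in
`ℚ(ζ_m)`). [cite: GalleseGoodsonLombardo2024, §3 Thm. 3.0 (5) and §3.2 Lemma 12] [cite: Shimura1998, §8.4 Example (1) (p. 85)] -/
theorem two_mul_finrank_traceField_of_four_dvd (h4 : 4 ∣ m) (h8 : 8 ≤ m) (h20 : m ≠ 20) (h24 : m ≠ 24) (h60 : m ≠ 60)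
    (Φ : CMType K) (hΦ : ∀ σ : K →+* ℂ, σ ∈ Φ.1 ↔ 2 * (expOf m K σ).val < m) :
    2 * finrank ℚ (traceField Φ) = Nat.totient m := by
  haveI : IsAbelianGalois ℚ K := IsCyclotomicExtension.isAbelianGalois {m} ℚ K
  obtain ⟨K₁, Φ₁, h₁, hp₁, -⟩ := exists_primitive_inducedCMType_index_two_of_four_dvd h4 h8 h20 h24 h60 Φ hΦ
  obtain ⟨-, -, -, -, -, -, -, hdeg, -⟩ := eq_fixedField_and_eq_adjoin_of_primitive_of_four_dvd h4 h8 h20 h24 h60 Φ hΦ Φ₁ h₁ hp₁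
  rw [finrank_traceField_eq_of_primitive_subpair Φ Φ₁ h₁ hp₁, hdeg]

/-- **The reflex field of `Φ_m` (`4 ∣ m ≥ 8`, `m ∉ {20, 24, 60}`) is a PROPER subfield of `x(ℚ(ζ_m))`** — so it is NOT `ℚ(ζ_m)`:
`traceField Φ < x(K)` (it is `x(K₁)`, `[K : K₁] = 2`). [cite: GalleseGoodsonLombardo2024, §3.5 Prop. 13 (proof) — corrected at `4 ∣ d`; §3 Thm. 3.0 (5)]
[cite: Shimura1998, §8.4 Example (1) (p. 85)] -/
theorem traceField_lt_fieldRange_of_four_dvd (h4 : 4 ∣ m) (h8 : 8 ≤ m) (h20 : m ≠ 20) (h24 : m ≠ 24) (h60 : m ≠ 60)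
    (Φ : CMType K) (hΦ : ∀ σ : K →+* ℂ, σ ∈ Φ.1 ↔ 2 * (expOf m K σ).val < m) (x : K →+* ℂ) :
    traceField Φ < x.toRatAlgHom.fieldRange := by
  haveI : IsAbelianGalois ℚ K := IsCyclotomicExtension.isAbelianGalois {m} ℚ K
  obtain ⟨K₁, Φ₁, h₁, hp₁, -⟩ := exists_primitive_inducedCMType_index_two_of_four_dvd h4 h8 h20 h24 h60 Φ hΦ
  obtain ⟨-, -, -, -, -, -, -, hdeg, -⟩ := eq_fixedField_and_eq_adjoin_of_primitive_of_four_dvd h4 h8 h20 h24 h60 Φ hΦ Φ₁ h₁ hp₁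
  have hK : finrank ℚ K = Nat.totient m :=
    IsCyclotomicExtension.finrank (K := ℚ) (n := m) K
      (Polynomial.cyclotomic.irreducible_rat (Nat.pos_of_ne_zero (NeZero.ne m)))
  have htot : 0 < Nat.totient m := Nat.totient_pos.2 (by omega)
  refine lt_of_le_of_ne ?_ fun heq => ?_
  · rw [traceField_eq_map_of_primitive_subpair Φ Φ₁ h₁ hp₁ x, AlgHom.fieldRange_eq_map]
    exact IntermediateField.map_mono _ le_top
  · have h := congrArg (fun F : IntermediateField ℚ ℂ => finrank ℚ F) heq
    rw [finrank_traceField_eq_of_primitive_subpair Φ Φ₁ h₁ hp₁, finrank_fieldRange x, hK] at h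
    omega

/-- `traceField Φ_m ≠ x(ℚ(ζ_m))` (`4 ∣ m ≥ 8`, `m ∉ {20, 24, 60}`). [cite: GalleseGoodsonLombardo2024, §3.5 Prop. 13 (proof) — corrected at `4 ∣ d`]
[cite: Shimura1998, §8.4 Example (1) (p. 85)] -/
theorem traceField_ne_fieldRange_of_four_dvd (h4 : 4 ∣ m) (h8 : 8 ≤ m) (h20 : m ≠ 20) (h24 : m ≠ 24) (h60 : m ≠ 60)
    (Φ : CMType K) (hΦ : ∀ σ : K →+* ℂ, σ ∈ Φ.1 ↔ 2 * (expOf m K σ).val < m) (x : K →+* ℂ) :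
    traceField Φ ≠ x.toRatAlgHom.fieldRange :=
  (traceField_lt_fieldRange_of_four_dvd h4 h8 h20 h24 h60 Φ hΦ x).ne

end FourDvd

/-! ## §4 `m ∈ {20, 24, 60}`: the reflex field of `Φ_m` is `F_m` — `ℚ(√−5)`, `ℚ(√−6)`, `ℚ(root of x⁴ + 15x² + 45)` -/

section Exceptional

variable {K : Type} [Field K] [NumberField K]

/-- Shared skeleton of §4: at a level whose pattern classes have `n` elements, the reflex field is the image of the primitive
subfield, of degree `[K₁ : ℚ]`. [cite: Shimura1998, §8.4 Example (1) (p. 85) and §8.2 Prop. 26] -/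
private theorem traceField_eq_map_of_ncard [IsAbelianGalois ℚ K] {n : ℕ} (Φ : CMType K) (x : K →+* ℂ)
    (hn : {t : K →+* ℂ | ∀ τ : ℂ ≃+* ℂ, (τ : ℂ →+* ℂ).comp x ∈ Φ.1 ↔ (τ : ℂ →+* ℂ).comp t ∈ Φ.1}.ncard = n) :
    ∃ (K₁ : IntermediateField ℚ K) (Φ₁ : CMType K₁),
      inducedCMType (algebraMap K₁ K) Φ₁ = Φ ∧
      (∀ s t : K₁ →+* ℂ,
        (∀ τ : ℂ ≃+* ℂ, (τ : ℂ →+* ℂ).comp s ∈ Φ₁.1 ↔ (τ : ℂ →+* ℂ).comp t ∈ Φ₁.1) → s = t) ∧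
      finrank K₁ K = n ∧ traceField Φ = K₁.map x.toRatAlgHom ∧ finrank ℚ (traceField Φ) = finrank ℚ K₁ := by
  obtain ⟨K₁, Φ₁, h₁, hp₁, hfin⟩ := exists_primitive_inducedCMType_finrank_eq Φ hn
  exact ⟨K₁, Φ₁, h₁, hp₁, hfin, traceField_eq_map_of_primitive_subpair Φ Φ₁ h₁ hp₁ x,
    finrank_traceField_eq_of_primitive_subpair Φ Φ₁ h₁ hp₁⟩

/-- **`m = 20`: the reflex field of `Φ_{20}` is `x(F_{20}) = ℚ(x r)`, `r = ζ + ζ³ + ζ⁷ + ζ⁹`, `(x r)² = −5` — i.e. `ℚ(√−5) ⊂ ℂ`,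
of degree `2`, NOT `ℚ(ζ_{20})`.** [cite: GalleseGoodsonLombardo2024, §3.4 and §3.5 Lemma 14 (`F_{20} = ℚ(√−5)`), Prop. 13 (proof) — corrected]
[cite: Shimura1998, §8.4 Example (1) (p. 85)] [cite: MilneCM2006, Ch. I §1 Prop. 1.18 (c)] -/
theorem traceField_twenty [IsCyclotomicExtension {20} ℚ K] (Φ : CMType K)
    (hΦ : ∀ σ : K →+* ℂ, σ ∈ Φ.1 ↔ 2 * (expOf 20 K σ).val < 20) (x : K →+* ℂ) :
    traceField Φ = IntermediateField.adjoin ℚ {x (zetaOf 20 K + zetaOf 20 K ^ 3 + zetaOf 20 K ^ 7 + zetaOf 20 K ^ 9)} ∧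
    (x (zetaOf 20 K + zetaOf 20 K ^ 3 + zetaOf 20 K ^ 7 + zetaOf 20 K ^ 9)) ^ 2 = -5 ∧
    finrank ℚ (traceField Φ) = 2 ∧ traceField Φ ≠ x.toRatAlgHom.fieldRange := by
  haveI : NeZero (20 : ℕ) := ⟨by norm_num⟩
  haveI : IsAbelianGalois ℚ K := IsCyclotomicExtension.isAbelianGalois {20} ℚ K
  obtain ⟨K₁, Φ₁, h₁, hp₁, -, htr, hfr⟩ := traceField_eq_map_of_ncard Φ x (ncard_setOf_pattern_half_twenty Φ hΦ x)
  obtain ⟨hr, -, -, hdeg, hK₁⟩ := primitiveSubfield_twenty Φ hΦ Φ₁ h₁ hp₁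
  have hK : finrank ℚ K = 8 := by
    rw [IsCyclotomicExtension.finrank (K := ℚ) (n := 20) K (Polynomial.cyclotomic.irreducible_rat (by norm_num))]; decide
  have hfr2 : finrank ℚ (traceField Φ) = 2 := by rw [hfr, hdeg]
  refine ⟨?_, ?_, hfr2, fun heq => ?_⟩
  · rw [htr, hK₁, IntermediateField.adjoin_map, Set.image_singleton]; rfl
  · rw [← map_pow, hr, map_neg]
    exact congrArg Neg.neg (map_ofNat x _)
  · have h := congrArg (fun F : IntermediateField ℚ ℂ => finrank ℚ F) heq
    rw [hfr2, finrank_fieldRange x, hK] at h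
    omega

/-- **`m = 24`: the reflex field of `Φ_{24}` is `ℚ(x r)`, `r = ζ + ζ⁵ + ζ⁷ + ζ¹¹`, `(x r)² = −6` — `ℚ(√−6) ⊂ ℂ`, degree `2`,
NOT `ℚ(ζ_{24})`.** [cite: GalleseGoodsonLombardo2024, §3.4 and §3.5 Lemma 14 (`F_{24} = ℚ(√−6)`), Prop. 13 (proof) — corrected]
[cite: Shimura1998, §8.4 Example (1) (p. 85)] [cite: MilneCM2006, Ch. I §1 Prop. 1.18 (c)] -/
theorem traceField_twentyFour [IsCyclotomicExtension {24} ℚ K] (Φ : CMType K)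
    (hΦ : ∀ σ : K →+* ℂ, σ ∈ Φ.1 ↔ 2 * (expOf 24 K σ).val < 24) (x : K →+* ℂ) :
    traceField Φ = IntermediateField.adjoin ℚ {x (zetaOf 24 K + zetaOf 24 K ^ 5 + zetaOf 24 K ^ 7 + zetaOf 24 K ^ 11)} ∧
    (x (zetaOf 24 K + zetaOf 24 K ^ 5 + zetaOf 24 K ^ 7 + zetaOf 24 K ^ 11)) ^ 2 = -6 ∧
    finrank ℚ (traceField Φ) = 2 ∧ traceField Φ ≠ x.toRatAlgHom.fieldRange := by
  haveI : NeZero (24 : ℕ) := ⟨by norm_num⟩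
  haveI : IsAbelianGalois ℚ K := IsCyclotomicExtension.isAbelianGalois {24} ℚ K
  obtain ⟨K₁, Φ₁, h₁, hp₁, -, htr, hfr⟩ := traceField_eq_map_of_ncard Φ x (ncard_setOf_pattern_half_twentyFour Φ hΦ x)
  obtain ⟨hr, -, -, hdeg, hK₁⟩ := primitiveSubfield_twentyFour Φ hΦ Φ₁ h₁ hp₁
  have hK : finrank ℚ K = 8 := by
    rw [IsCyclotomicExtension.finrank (K := ℚ) (n := 24) K (Polynomial.cyclotomic.irreducible_rat (by norm_num))]; decide
  have hfr2 : finrank ℚ (traceField Φ) = 2 := by rw [hfr, hdeg]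
  refine ⟨?_, ?_, hfr2, fun heq => ?_⟩
  · rw [htr, hK₁, IntermediateField.adjoin_map, Set.image_singleton]; rfl
  · rw [← map_pow, hr, map_neg]
    exact congrArg Neg.neg (map_ofNat x _)
  · have h := congrArg (fun F : IntermediateField ℚ ℂ => finrank ℚ F) heq
    rw [hfr2, finrank_fieldRange x, hK] at h
    omega

/-- **`m = 60`: the reflex field of `Φ_{60}` is `ℚ(x r)`, `r = ζ + ζ¹¹ + ζ¹⁹ + ζ²⁹`, `(x r)⁴ + 15 (x r)² + 45 = 0` — the field `F_{60}`
read in `ℂ`, of degree `4`, NOT `ℚ(ζ_{60})`.** [cite: GalleseGoodsonLombardo2024, §3.4 and §3.5 Lemma 14 (`F_{60}`), Prop. 13 (proof) — corrected]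
[cite: Shimura1998, §8.4 Example (1) (p. 85)] [cite: MilneCM2006, Ch. I §1 Prop. 1.18 (c)] -/
theorem traceField_sixty [IsCyclotomicExtension {60} ℚ K] (Φ : CMType K)
    (hΦ : ∀ σ : K →+* ℂ, σ ∈ Φ.1 ↔ 2 * (expOf 60 K σ).val < 60) (x : K →+* ℂ) :
    traceField Φ = IntermediateField.adjoin ℚ {x (zetaOf 60 K + zetaOf 60 K ^ 11 + zetaOf 60 K ^ 19 + zetaOf 60 K ^ 29)} ∧
    (x (zetaOf 60 K + zetaOf 60 K ^ 11 + zetaOf 60 K ^ 19 + zetaOf 60 K ^ 29)) ^ 4 +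
        15 * (x (zetaOf 60 K + zetaOf 60 K ^ 11 + zetaOf 60 K ^ 19 + zetaOf 60 K ^ 29)) ^ 2 + 45 = 0 ∧
    finrank ℚ (traceField Φ) = 4 ∧ traceField Φ ≠ x.toRatAlgHom.fieldRange := by
  haveI : NeZero (60 : ℕ) := ⟨by norm_num⟩
  haveI : IsAbelianGalois ℚ K := IsCyclotomicExtension.isAbelianGalois {60} ℚ K
  obtain ⟨K₁, Φ₁, h₁, hp₁, -, htr, hfr⟩ := traceField_eq_map_of_ncard Φ x (ncard_setOf_pattern_half_sixty Φ hΦ x)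
  obtain ⟨hr, -, -, -, hdeg, hK₁⟩ := primitiveSubfield_sixty Φ hΦ Φ₁ h₁ hp₁
  have hK : finrank ℚ K = 16 := by
    rw [IsCyclotomicExtension.finrank (K := ℚ) (n := 60) K (Polynomial.cyclotomic.irreducible_rat (by norm_num))]; decide
  have hfr4 : finrank ℚ (traceField Φ) = 4 := by rw [hfr, hdeg]
  refine ⟨?_, ?_, hfr4, fun heq => ?_⟩
  · rw [htr, hK₁, IntermediateField.adjoin_map, Set.image_singleton]; rfl
  · have h := congrArg x hr
    rw [map_zero, map_add, map_add, map_pow, map_mul, map_pow, map_ofNat x 15, map_ofNat x 45] at h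
    exact h
  · have h := congrArg (fun F : IntermediateField ℚ ℂ => finrank ℚ F) heq
    rw [hfr4, finrank_fieldRange x, hK] at h
    omega

end Exceptional

end HyperellipticJacobian

end Literature.AlgebraicGeometry.ComplexMultiplication

end
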